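import Summits.ValiantsHypothesis.ValiantsHypothesis.Theorems.MonotoneRestorationOrbitRestorationQPHomogeneousReduction
import HarnessLib

/-!
# A_∞ in canonical form: uniform, explicit and homogeneous at once (crux `OrbitRestorationQP`, stmt-ValiantsHypothesis-18293)

Line `depth_three_rung`, stub `stub_sigmaPiSigmaValue` (A_∞); namespace
`Summit.ValiantsHypothesis.ValiantsHypothesis.Theorems.OrbitRestorationQPDepthThreeRung.HomogeneousReduction`.

Combining the three landed reformulations — `UniformForm.sigmaPiSigmaValue_iff_uniform` (one constant per exponent),
`ExplicitForm.sigmaPiSigmaValue_iff_explicit'` (explicit `ΣΠΣ` data, no circuit class) and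
`HomogeneousReduction.sigmaPiSigmaValue_iff_homogeneous` (homogeneous polynomials suffice):

* `sigmaPiSigmaValue_iff_canonical` — **A_∞ ⟺ ∀ c ∃ c' ∀ n: every HOMOGENEOUS matrix-symmetric polynomial at level `n`
  given as `Σ_{i<k} C(a i) · Π (L i)` with `k ≤ n^c + c` and every `L i` a multiset of `≤ n^c + c` polynomials of total
  degree `≤ 1` is `QPOrbitRestorable c' n`.**

This is the planner-ready restatement of the stub: levelwise, with explicit data, one constant per exponent, homogeneous
target.  Honest label: a reformulation; no stub is closed; VP ≠ VNP is not touched. [folklore]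
-/

noncomputable section

open scoped Classical

-- `Summit.ValiantsHypothesis.ValiantsHypothesis.…` is the tree's single-conjunct layout (Sub = Summit).
set_option linter.dupNamespace false

namespace Summit.ValiantsHypothesis.ValiantsHypothesis.Theorems.OrbitRestorationQPDepthThreeRung

namespace HomogeneousReduction

open Literature.Computability.AlgebraicComplexity MvPolynomial
open Summit.ValiantsHypothesis.ValiantsHypothesis.Theorems

/-- **A_∞ IN CANONICAL FORM** (uniform + explicit + homogeneous). [folklore] -/
theorem sigmaPiSigmaValue_iff_canonical :
    (∀ f : (n : ℕ) → MvPolynomial (Fin n × Fin n) ℂ, IsMatrixSymmetric f →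
        (∃ c : ℕ, ∀ n : ℕ, PDClass (fun _ => 1) n c (f n)) →
        ∃ c : ℕ, ∀ n : ℕ, QPOrbitRestorable c n (f n)) ↔
    (∀ c : ℕ, ∃ c' : ℕ, ∀ (n : ℕ) (q : MvPolynomial (Fin n × Fin n) ℂ),
        (∀ σ τ : Equiv.Perm (Fin n), MvPolynomial.rename (fun p : Fin n × Fin n => (σ p.1, τ p.2)) q = q) →
        (∃ d : ℕ, q.IsHomogeneous d) →
        (∃ (k : ℕ) (a : Fin k → ℂ) (L : Fin k → Multiset (MvPolynomial (Fin n × Fin n) ℂ)),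
            (∀ i, ∀ ℓ ∈ L i, ℓ.totalDegree ≤ 1) ∧ k ≤ n ^ c + c ∧
            (∀ i, Multiset.card (L i) ≤ n ^ c + c) ∧ q = ∑ i, MvPolynomial.C (a i) * (L i).prod) →
        QPOrbitRestorable c' n q) := by
  rw [sigmaPiSigmaValue_iff_homogeneous]
  constructor
  · intro hH c
    obtain ⟨c', hc'⟩ := hH (2 * (2 * c + 8) + 3 ^ (2 * c + 8))
    refine ⟨c', fun n q hs hhom hexp => hc' n q hs hhom ?_⟩
    obtain ⟨k, a, L, hdeg, hk, hcard, hq⟩ := hexp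
    rw [hq]
    exact ExplicitForm.pdClass_one_of_explicit (by rw [Fintype.card_fin]; exact hk) a L hdeg hcard
  · intro hC c
    obtain ⟨c', hc'⟩ := hC (c + 2)
    refine ⟨c', fun n q hs hhom hpd => hc' n q hs hhom ?_⟩
    obtain ⟨k, a, L, hdeg, hk, hcard, hq⟩ := ExplicitForm.exists_explicit_of_pdClassOne hpd
    exact ⟨k, a, L, hdeg, hk, hcard, hq⟩

end HomogeneousReduction

end Summit.ValiantsHypothesis.ValiantsHypothesis.Theorems.OrbitRestorationQPDepthThreeRung

end
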